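import Mathlib
import HarnessLib

/-!
# Discs containing at least one zero of a polynomial (Henrici §6.4.II)

Topic: Algebra / Polynomial (`Literature/Algebra/Polynomial/`).

Let `p` be a polynomial of degree `n ≥ 1` over a normed field `K` which SPLITS over `K`
(`Polynomial.Splits p`; automatic over `ℂ`, `IsAlgClosed.splits p`), with zeros `w₁, …, wₙ`
(the multiset `p.roots`), let `z₀ ∈ K` and write `b m := (taylor z₀ p).coeff m = p⁽ᵐ⁾(z₀)/m!`
for the Taylor coefficients of `p` at `z₀` (`b 0 = p(z₀)`, `b 1 = p'(z₀)`, `b n = aₙ`).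
Henrici [Henrici1974, §6.4.II "Disks containing at least one zero"] observes that, `p(z₀ + h)`
having the zeros `h_m = w_m - z₀`, Vieta's formulas give
`b_m / b_0 = ± e_{n-m}(h) / (h₁ ⋯ hₙ) = ± e_m(1/h₁, …, 1/hₙ)`, whence, with
`ρ := min_m |w_m - z₀|` the distance from `z₀` to the NEAREST zero,

  `|b_m| ρ^m ≤ (n choose m) |b_0|`, `m = 0, …, n`            (6.4-8)/(6.4-9)

(`exists_root_forall_norm_taylor_coeff_mul_pow_le`, the master inequality, stated at a nearest
zero `w`). Its consequences are the discs about `z₀` guaranteed to contain AT LEAST ONE zero: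

* `exists_root_norm_sub_le_of_choose_mul_le` — **Theorem 6.4e** in certificate form: if
  `(n choose m) |p(z₀)| ≤ |b_m| β^m` for some `1 ≤ m ≤ n` with `b_m ≠ 0` and `β ≥ 0`, some zero
  satisfies `|w - z₀| ≤ β` (Henrici's `β(z₀) = min_m [(n choose m) |b₀/b_m|]^{1/m}` is the least
  such certificate);
* `exists_root_norm_sub_pow_le`, `exists_root_norm_sub_le_of_eval_le`,
  `exists_root_norm_sub_le_rpow` — **Corollary 6.4f** (`m = n`): `|aₙ| |w - z₀|ⁿ ≤ |p(z₀)|` for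
  some zero, i.e. the disc `|z - z₀| ≤ (|p(z₀)|/|aₙ|)^{1/n}` contains a zero;
* `exists_root_norm_sub_le_natDegree_mul_div` — **Corollary 6.4g** (`m = 1`): if `p'(z₀) ≠ 0`
  the disc `|z - z₀| ≤ n |p(z₀)/p'(z₀)|` (the `n`-fold Newton correction) contains a zero;
* `exists_root_two_mul_pow_le`, `exists_root_norm_sub_le_div_rpow_sub_one` — **Theorem 6.4i**
  (G. D. Birkhoff): if `ρ₁ ≥ 0` satisfies `|p(z₀)| ≤ Σ_{m=1}^{n} |b_m| ρ₁^m` (every `ρ₁` at least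
  the Cauchy exclusion radius of Thm 6.4d does), then some zero satisfies
  `2 |w - z₀|ⁿ ≤ (|w - z₀| + ρ₁)ⁿ`, i.e. `|w - z₀| ≤ ρ₁ / (2^{1/n} - 1)`.

Relation to the tree. The companion anchor `InclusionRadius.lean` (Henrici §6.4.I/III) gives
discs containing NO zero / ALL zeros by elementary estimates valid WITHOUT splitting;
`Literature.Analysis.Complex.PelletTheorem` counts zeros in a disc over `ℂ` by Rouché. The
mechanism of Cor 6.4f (`|p(z₀)| = |aₙ| ∏ |z₀ - w_m| ≥ |aₙ| ρⁿ`) is used privately, for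
characteristic polynomials of complex matrices, inside
`Literature.LinearAlgebra.Matrix.SpectralVariation` (Elsner's theorem) and, in an ultrametric
setting, in a Langlands summit file; no polynomial-level statement of §6.4.II existed.
Not formalised: Theorem 6.4h for `k ≥ 2` (power sums `s_k` of the reciprocal zeros via the
Newton-type recurrence (6.4-11)) and Laguerre's refinement (Thm 6.5d).

Conventions. `K` is any normed field and `p.Splits` is an explicit hypothesis (Henrici: `ℂ`,
leading coefficient normalised to `1` — here `‖p.leadingCoeff‖` is kept explicit, which is why
Cor 6.4f reads `(|p(z₀)|/|aₙ|)^{1/n}`); zeros are the elements of the multiset `p.roots`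
(`w ∈ p.roots ↔ p ≠ 0 ∧ p.IsRoot w`); `n = p.natDegree ≥ 1` is assumed where needed (a nonzero
constant has no zeros). The nearest zero is any `w ∈ p.roots` minimising `‖w - z₀‖`.
-/

noncomputable section

open Polynomial Finset

namespace Literature.Algebra.Polynomial.NearestZeroBounds

variable {K : Type*} [NormedField K]

/-! ## Multiset bookkeeping -/

/-- `‖∏ u‖ = ∏ ‖·‖` over a multiset. [folklore] -/
private theorem norm_multiset_prod (u : Multiset K) : ‖u.prod‖ = (u.map fun x => ‖x‖).prod := by
  have h := map_multiset_prod (normHom : K →*₀ ℝ) u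
  simpa only [normHom_apply] using h

/-- If every element of the multiset `u` has norm `≥ ρ ≥ 0`, then `ρ ^ card u ≤ ‖∏ u‖`.
[folklore] -/
private theorem pow_card_le_norm_prod {ρ : ℝ} (hρ : 0 ≤ ρ) :
    ∀ u : Multiset K, (∀ x ∈ u, ρ ≤ ‖x‖) → ρ ^ Multiset.card u ≤ ‖u.prod‖ := by
  intro u
  induction u using Multiset.induction_on with
  | empty => intro _; simp
  | cons a t ih =>
    intro h
    rw [Multiset.prod_cons, norm_mul, Multiset.card_cons, pow_succ']
    exact mul_le_mul (h a (Multiset.mem_cons_self a t))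
      (ih fun x hx => h x (Multiset.mem_cons_of_mem hx)) (pow_nonneg hρ _) (norm_nonneg _)

/-- **The Vieta bound behind (6.4-8).** If every element of the multiset `H` (of cardinality
`j + m`) has norm at least `ρ ≥ 0`, then the elementary symmetric function `e_j(H)` satisfies
`‖e_j(H)‖ ρ^m ≤ (j + m choose m) ‖∏ H‖`: each of the `(j+m choose j)` products of `j` elements,
multiplied by `ρ^m`, is at most the full product in norm. [cite: Henrici1974, §6.4 (6.4-8)] -/
theorem norm_esymm_mul_pow_le {H : Multiset K} {ρ : ℝ} (hρ : 0 ≤ ρ) (hH : ∀ x ∈ H, ρ ≤ ‖x‖)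
    {j m : ℕ} (hjm : j + m = Multiset.card H) :
    ‖H.esymm j‖ * ρ ^ m ≤ ((j + m).choose m : ℝ) * ‖H.prod‖ := by
  unfold Multiset.esymm
  have hterm : ∀ t ∈ H.powersetCard j, ‖t.prod‖ * ρ ^ m ≤ ‖H.prod‖ := by
    intro t ht
    rw [Multiset.mem_powersetCard] at ht
    obtain ⟨u, hu⟩ := Multiset.le_iff_exists_add.mp ht.1
    have hcu : Multiset.card u = m := by
      have := congrArg Multiset.card hu
      rw [Multiset.card_add, ht.2] at this
      omega
    have hu' : ∀ x ∈ u, ρ ≤ ‖x‖ := fun x hx => hH x (by rw [hu]; exact Multiset.mem_add.mpr (Or.inr hx))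
    calc ‖t.prod‖ * ρ ^ m ≤ ‖t.prod‖ * ‖u.prod‖ := by
          rw [← hcu]
          exact mul_le_mul_of_nonneg_left (pow_card_le_norm_prod hρ u hu') (norm_nonneg _)
      _ = ‖H.prod‖ := by rw [hu, Multiset.prod_add, norm_mul]
  calc ‖((H.powersetCard j).map Multiset.prod).sum‖ * ρ ^ m
      ≤ (((H.powersetCard j).map Multiset.prod).map fun x => ‖x‖).sum * ρ ^ m :=
        mul_le_mul_of_nonneg_right (norm_multiset_sum_le _) (pow_nonneg hρ _)
    _ = ((H.powersetCard j).map fun t => ‖t.prod‖ * ρ ^ m).sum := by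
        rw [Multiset.map_map, Multiset.sum_map_mul_right]
        rfl
    _ ≤ ((H.powersetCard j).map fun _ => ‖H.prod‖).sum :=
        Multiset.sum_map_le_sum_map _ _ hterm
    _ = ((j + m).choose m : ℝ) * ‖H.prod‖ := by
        rw [Multiset.map_const', Multiset.sum_replicate, Multiset.card_powersetCard, nsmul_eq_mul,
          ← hjm, Nat.choose_symm_add]

/-! ## Taylor coefficients at `z₀` versus the shifted zeros `w - z₀` -/

/-- For a splitting `p`: `taylor z₀ p = C aₙ · ∏_{w ∈ roots p} (X - C (w - z₀))`. [folklore] -/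
private theorem taylor_eq_C_mul_prod {p : K[X]} (hs : p.Splits) (z₀ : K) :
    taylor z₀ p = C p.leadingCoeff * ((p.roots.map fun w => w - z₀).map fun h => X - C h).prod := by
  conv_lhs => rw [taylor_apply, hs.eq_prod_roots]
  rw [mul_comp, C_comp, multiset_prod_comp, Multiset.map_map, Multiset.map_map]
  congr 1
  refine congrArg Multiset.prod (Multiset.map_congr rfl fun w _ => ?_)
  simp only [Function.comp_apply, sub_comp, X_comp, C_comp, map_sub]
  ring

/-- Vieta for the Taylor coefficients: with `H = {w - z₀ : w ∈ roots p}` (cardinality `n`),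
`b_k = aₙ · (-1)^{n-k} e_{n-k}(H)` for `k ≤ n`. [folklore] -/
private theorem taylor_coeff_eq {p : K[X]} (hs : p.Splits) (z₀ : K) {k : ℕ} (hk : k ≤ p.natDegree) :
    (taylor z₀ p).coeff k = p.leadingCoeff *
      ((-1) ^ (p.natDegree - k) * (p.roots.map fun w => w - z₀).esymm (p.natDegree - k)) := by
  have hcard : Multiset.card (p.roots.map fun w => w - z₀) = p.natDegree := by
    rw [Multiset.card_map, ← hs.natDegree_eq_card_roots]
  rw [taylor_eq_C_mul_prod hs z₀, coeff_C_mul, Multiset.prod_X_sub_C_coeff _ (hcard.symm ▸ hk),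
    hcard]

/-- `‖b_k‖ = ‖aₙ‖ · ‖e_{n-k}(H)‖` for `k ≤ n`. [folklore] -/
private theorem norm_taylor_coeff_eq {p : K[X]} (hs : p.Splits) (z₀ : K) {k : ℕ} (hk : k ≤ p.natDegree) :
    ‖(taylor z₀ p).coeff k‖ =
      ‖p.leadingCoeff‖ * ‖(p.roots.map fun w => w - z₀).esymm (p.natDegree - k)‖ := by
  rw [taylor_coeff_eq hs z₀ hk, norm_mul, norm_mul, norm_pow, norm_neg, norm_one, one_pow,
    one_mul]

/-- `‖p(z₀)‖ = ‖aₙ‖ · ∏_{w} ‖w - z₀‖ = ‖aₙ‖ · ‖∏ H‖`. [folklore] -/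
private theorem norm_eval_eq {p : K[X]} (hs : p.Splits) (z₀ : K) :
    ‖p.eval z₀‖ = ‖p.leadingCoeff‖ * ‖(p.roots.map fun w => w - z₀).prod‖ := by
  rw [hs.eval_eq_prod_roots z₀, norm_mul, norm_multiset_prod, norm_multiset_prod,
    Multiset.map_map, Multiset.map_map]
  congr 2
  exact Multiset.map_congr rfl fun w _ => by simp [norm_sub_rev]

/-! ## The master inequality (6.4-8) at a nearest zero -/

/-- A splitting polynomial of positive degree has a zero NEAREST to `z₀`. [folklore] -/
private theorem exists_nearest_root {p : K[X]} (hs : p.Splits) (hn : 0 < p.natDegree) (z₀ : K) :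
    ∃ w ∈ p.roots, ∀ w' ∈ p.roots, ‖w - z₀‖ ≤ ‖w' - z₀‖ := by
  classical
  have hne : p.roots.toFinset.Nonempty := by
    rw [hs.natDegree_eq_card_roots, Multiset.card_pos_iff_exists_mem] at hn
    obtain ⟨w, hw⟩ := hn
    exact ⟨w, Multiset.mem_toFinset.mpr hw⟩
  obtain ⟨w, hw, hmin⟩ := p.roots.toFinset.exists_min_image (fun w => ‖w - z₀‖) hne
  exact ⟨w, Multiset.mem_toFinset.mp hw, fun w' hw' => hmin w' (Multiset.mem_toFinset.mpr hw')⟩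

/-- **Henrici (6.4-8)/(6.4-9): the Taylor coefficients see the nearest zero.** Let `p` split,
`deg p = n ≥ 1`, `z₀ ∈ K`. There is a zero `w` of `p` nearest to `z₀` and, with `ρ = ‖w - z₀‖`,
`‖b_m‖ ρ^m ≤ (n choose m) ‖p(z₀)‖` for every `m ≤ n`, where `b_m = (taylor z₀ p).coeff m`.
(Henrici normalises `aₙ = 1` and assumes `p(z₀) ≠ 0`; neither is needed for the inequality.)
Proof: `b_m = ± aₙ e_{n-m}(w₁ - z₀, …, wₙ - z₀)`, `p(z₀) = ± aₙ ∏ (w_k - z₀)`, and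
`norm_esymm_mul_pow_le`. [cite: Henrici1974, §6.4 Thm 6.4e, (6.4-8)] -/
theorem exists_root_forall_norm_taylor_coeff_mul_pow_le {p : K[X]} (hs : p.Splits)
    (hn : 0 < p.natDegree) (z₀ : K) :
    ∃ w ∈ p.roots, (∀ w' ∈ p.roots, ‖w - z₀‖ ≤ ‖w' - z₀‖) ∧
      ∀ m ≤ p.natDegree, ‖(taylor z₀ p).coeff m‖ * ‖w - z₀‖ ^ m ≤
        (p.natDegree.choose m : ℝ) * ‖p.eval z₀‖ := by
  obtain ⟨w, hw, hmin⟩ := exists_nearest_root hs hn z₀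
  refine ⟨w, hw, hmin, fun m hm => ?_⟩
  have hH : ∀ x ∈ p.roots.map (fun w' => w' - z₀), ‖w - z₀‖ ≤ ‖x‖ := by
    intro x hx
    obtain ⟨w', hw', rfl⟩ := Multiset.mem_map.mp hx
    exact hmin w' hw'
  have hcard : Multiset.card (p.roots.map fun w' => w' - z₀) = p.natDegree := by
    rw [Multiset.card_map, ← hs.natDegree_eq_card_roots]
  have hjm : (p.natDegree - m) + m = Multiset.card (p.roots.map fun w' => w' - z₀) := by
    rw [hcard]; omega
  have key := norm_esymm_mul_pow_le (norm_nonneg (w - z₀)) hH hjm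
  rw [show p.natDegree - m + m = p.natDegree by omega] at key
  rw [norm_taylor_coeff_eq hs z₀ hm, norm_eval_eq hs z₀, mul_assoc, mul_left_comm _ _ ‖_‖]
  exact mul_le_mul_of_nonneg_left key (norm_nonneg _)

/-! ## Theorem 6.4e and its corollaries -/

/-- **Theorem 6.4e (certificate form).** Let `p` split, `n = deg p ≥ 1`, `1 ≤ m ≤ n`,
`b_m = (taylor z₀ p).coeff m ≠ 0`, `β ≥ 0`, and `(n choose m) ‖p(z₀)‖ ≤ ‖b_m‖ β^m`. Then the
closed disc `‖z - z₀‖ ≤ β` contains at least one zero of `p`. Henrici's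
`β(z₀) := min_{1 ≤ m ≤ n, b_m ≠ 0} [(n choose m) |b₀ / b_m|]^{1/m}` ((6.4-5)) is the least such
`β`. [cite: Henrici1974, §6.4 Thm 6.4e] -/
theorem exists_root_norm_sub_le_of_choose_mul_le {p : K[X]} (hs : p.Splits) {z₀ : K} {m : ℕ}
    (hm1 : 1 ≤ m) (hmn : m ≤ p.natDegree) (hbm : (taylor z₀ p).coeff m ≠ 0) {β : ℝ} (hβ : 0 ≤ β)
    (h : (p.natDegree.choose m : ℝ) * ‖p.eval z₀‖ ≤ ‖(taylor z₀ p).coeff m‖ * β ^ m) :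
    ∃ w ∈ p.roots, ‖w - z₀‖ ≤ β := by
  obtain ⟨w, hw, -, hle⟩ :=
    exists_root_forall_norm_taylor_coeff_mul_pow_le hs (hm1.trans hmn) z₀
  refine ⟨w, hw, ?_⟩
  have h2 : ‖(taylor z₀ p).coeff m‖ * ‖w - z₀‖ ^ m ≤ ‖(taylor z₀ p).coeff m‖ * β ^ m :=
    (hle m hmn).trans h
  have h3 : ‖w - z₀‖ ^ m ≤ β ^ m := le_of_mul_le_mul_left h2 (norm_pos_iff.mpr hbm)
  exact (pow_le_pow_iff_left₀ (norm_nonneg _) hβ (by omega)).mp h3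

/-- **Corollary 6.4f (product form).** For a splitting `p` of degree `n ≥ 1` some zero `w`
satisfies `‖aₙ‖ ‖w - z₀‖ⁿ ≤ ‖p(z₀)‖` (the case `m = n` of (6.4-8): `‖p(z₀)‖ = ‖aₙ‖ ∏ ‖w_k - z₀‖`).
[cite: Henrici1974, §6.4 Cor 6.4f] -/
theorem exists_root_norm_sub_pow_le {p : K[X]} (hs : p.Splits) (hn : 0 < p.natDegree) (z₀ : K) :
    ∃ w ∈ p.roots, ‖p.leadingCoeff‖ * ‖w - z₀‖ ^ p.natDegree ≤ ‖p.eval z₀‖ := by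
  obtain ⟨w, hw, -, hle⟩ := exists_root_forall_norm_taylor_coeff_mul_pow_le hs hn z₀
  refine ⟨w, hw, ?_⟩
  have h := hle p.natDegree le_rfl
  rwa [coeff_taylor_natDegree, Nat.choose_self, Nat.cast_one, one_mul] at h

/-- **Corollary 6.4f (certificate form).** If `β ≥ 0` and `‖p(z₀)‖ ≤ ‖aₙ‖ βⁿ` (`p` splitting,
`n = deg p ≥ 1`), the closed disc `‖z - z₀‖ ≤ β` contains a zero of `p`.
[cite: Henrici1974, §6.4 Cor 6.4f] -/
theorem exists_root_norm_sub_le_of_eval_le {p : K[X]} (hs : p.Splits) (hn : 0 < p.natDegree)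
    {z₀ : K} {β : ℝ} (hβ : 0 ≤ β) (h : ‖p.eval z₀‖ ≤ ‖p.leadingCoeff‖ * β ^ p.natDegree) :
    ∃ w ∈ p.roots, ‖w - z₀‖ ≤ β := by
  obtain ⟨w, hw, hle⟩ := exists_root_norm_sub_pow_le hs hn z₀
  refine ⟨w, hw, ?_⟩
  have hp : p ≠ 0 := fun h0 => by rw [h0, natDegree_zero] at hn; exact lt_irrefl 0 hn
  have hlc : 0 < ‖p.leadingCoeff‖ := norm_pos_iff.mpr (leadingCoeff_ne_zero.mpr hp)
  have h3 : ‖w - z₀‖ ^ p.natDegree ≤ β ^ p.natDegree := le_of_mul_le_mul_left (hle.trans h) hlc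
  exact (pow_le_pow_iff_left₀ (norm_nonneg _) hβ hn.ne').mp h3

/-- **Corollary 6.4f (closed form).** For a splitting `p` of degree `n ≥ 1` the closed disc
`‖z - z₀‖ ≤ (‖p(z₀)‖ / ‖aₙ‖)^{1/n}` contains a zero of `p` (Henrici: `aₙ = 1`, radius
`|p(z₀)|^{1/n}`). Real powers are `Real.rpow`. [cite: Henrici1974, §6.4 Cor 6.4f] -/
theorem exists_root_norm_sub_le_rpow {p : K[X]} (hs : p.Splits) (hn : 0 < p.natDegree) (z₀ : K) :
    ∃ w ∈ p.roots, ‖w - z₀‖ ≤ (‖p.eval z₀‖ / ‖p.leadingCoeff‖) ^ ((p.natDegree : ℝ)⁻¹) := by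
  have hp : p ≠ 0 := fun h0 => by rw [h0, natDegree_zero] at hn; exact lt_irrefl 0 hn
  have hlc : 0 < ‖p.leadingCoeff‖ := norm_pos_iff.mpr (leadingCoeff_ne_zero.mpr hp)
  have hq : 0 ≤ ‖p.eval z₀‖ / ‖p.leadingCoeff‖ := div_nonneg (norm_nonneg _) hlc.le
  refine exists_root_norm_sub_le_of_eval_le hs hn (Real.rpow_nonneg hq _) ?_
  rw [Real.rpow_inv_natCast_pow hq hn.ne', mul_div_cancel₀ _ hlc.ne']

/-- **Corollary 6.4g (the `n`-fold Newton correction).** If `p` splits, `n = deg p ≥ 1` and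
`p'(z₀) ≠ 0`, the closed disc `‖z - z₀‖ ≤ n ‖p(z₀)‖ / ‖p'(z₀)‖` contains a zero of `p` (the case
`m = 1` of (6.4-8), `b₁ = p'(z₀)`; improved by Laguerre's theorem, not formalised here).
[cite: Henrici1974, §6.4 Cor 6.4g] -/
theorem exists_root_norm_sub_le_natDegree_mul_div {p : K[X]} (hs : p.Splits)
    (hn : 0 < p.natDegree) {z₀ : K} (h1 : p.derivative.eval z₀ ≠ 0) :
    ∃ w ∈ p.roots, ‖w - z₀‖ ≤ p.natDegree * ‖p.eval z₀‖ / ‖p.derivative.eval z₀‖ := by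
  obtain ⟨w, hw, -, hle⟩ := exists_root_forall_norm_taylor_coeff_mul_pow_le hs hn z₀
  refine ⟨w, hw, ?_⟩
  have h := hle 1 hn
  rw [taylor_coeff_one, pow_one, Nat.choose_one_right] at h
  have hd : 0 < ‖p.derivative.eval z₀‖ := norm_pos_iff.mpr h1
  rw [le_div_iff₀ hd, mul_comm]
  exact h

/-! ## Theorem 6.4i (G. D. Birkhoff) -/

/-- **Theorem 6.4i (Birkhoff), product form.** Let `p` split, `n = deg p ≥ 1`, and let
`ρ₁ ≥ 0` satisfy `‖p(z₀)‖ ≤ Σ_{m=1}^{n} ‖b_m‖ ρ₁^m` (for instance the Cauchy exclusion radius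
`ρ₁` of Thm 6.4d, where equality holds, or anything larger). Then a nearest zero `w` satisfies
`2 ‖w - z₀‖ⁿ ≤ (‖w - z₀‖ + ρ₁)ⁿ`: by (6.4-8),
`|b₀| ≤ Σ |b_m| ρ₁^m ≤ |b₀| Σ (n choose m) (ρ₁/ρ)^m = |b₀| ((1 + ρ₁/ρ)ⁿ - 1)`.
[cite: Henrici1974, §6.4 Thm 6.4i] -/
theorem exists_root_two_mul_pow_le {p : K[X]} (hs : p.Splits) (hn : 0 < p.natDegree) {z₀ : K}
    {ρ₁ : ℝ} (hρ₁ : 0 ≤ ρ₁)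
    (h : ‖p.eval z₀‖ ≤ ∑ m ∈ Icc 1 p.natDegree, ‖(taylor z₀ p).coeff m‖ * ρ₁ ^ m) :
    ∃ w ∈ p.roots, (∀ w' ∈ p.roots, ‖w - z₀‖ ≤ ‖w' - z₀‖) ∧
      2 * ‖w - z₀‖ ^ p.natDegree ≤ (‖w - z₀‖ + ρ₁) ^ p.natDegree := by
  obtain ⟨w, hw, hmin, hle⟩ := exists_root_forall_norm_taylor_coeff_mul_pow_le hs hn z₀
  refine ⟨w, hw, hmin, ?_⟩
  have hp : p ≠ 0 := fun h0 => by rw [h0, natDegree_zero] at hn; exact lt_irrefl 0 hn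
  set ρ := ‖w - z₀‖ with hρdef
  have hρ : 0 ≤ ρ := norm_nonneg _
  by_cases h0 : p.eval z₀ = 0
  · -- `z₀` is itself a zero, so the nearest zero is at distance `0`
    have hz : z₀ ∈ p.roots := (mem_roots hp).mpr h0
    have hρ0 : ρ = 0 := le_antisymm (by simpa using hmin z₀ hz) hρ
    rw [hρ0, zero_pow hn.ne', mul_zero, zero_add]
    exact pow_nonneg hρ₁ _
  · have hb0 : 0 < ‖p.eval z₀‖ := norm_pos_iff.mpr h0
    -- multiply the hypothesis by `ρⁿ` and bound each term by (6.4-8)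
    have hsum : ‖p.eval z₀‖ * ρ ^ p.natDegree ≤
        ‖p.eval z₀‖ * ∑ m ∈ Icc 1 p.natDegree,
          (p.natDegree.choose m : ℝ) * (ρ₁ ^ m * ρ ^ (p.natDegree - m)) := by
      calc ‖p.eval z₀‖ * ρ ^ p.natDegree
          ≤ (∑ m ∈ Icc 1 p.natDegree, ‖(taylor z₀ p).coeff m‖ * ρ₁ ^ m) * ρ ^ p.natDegree :=
            mul_le_mul_of_nonneg_right h (pow_nonneg hρ _)
        _ = ∑ m ∈ Icc 1 p.natDegree,
              (‖(taylor z₀ p).coeff m‖ * ρ ^ m) * (ρ₁ ^ m * ρ ^ (p.natDegree - m)) := by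
            rw [sum_mul]
            refine sum_congr rfl fun m hm => ?_
            have hmn : m ≤ p.natDegree := (mem_Icc.mp hm).2
            calc ‖(taylor z₀ p).coeff m‖ * ρ₁ ^ m * ρ ^ p.natDegree
                = ‖(taylor z₀ p).coeff m‖ * ρ₁ ^ m * (ρ ^ m * ρ ^ (p.natDegree - m)) := by
                  rw [← pow_add, Nat.add_sub_cancel' hmn]
              _ = _ := by ring
        _ ≤ ∑ m ∈ Icc 1 p.natDegree,
              ((p.natDegree.choose m : ℝ) * ‖p.eval z₀‖) * (ρ₁ ^ m * ρ ^ (p.natDegree - m)) :=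
            sum_le_sum fun m hm => mul_le_mul_of_nonneg_right (hle m (mem_Icc.mp hm).2)
              (mul_nonneg (pow_nonneg hρ₁ _) (pow_nonneg hρ _))
        _ = _ := by rw [mul_sum]; exact sum_congr rfl fun m _ => by ring
    -- the binomial theorem: `Σ_{m=1}^{n} (n choose m) ρ₁^m ρ^{n-m} = (ρ₁ + ρ)ⁿ - ρⁿ`
    have hbinom : ∑ m ∈ Icc 1 p.natDegree,
        (p.natDegree.choose m : ℝ) * (ρ₁ ^ m * ρ ^ (p.natDegree - m)) =
          (ρ₁ + ρ) ^ p.natDegree - ρ ^ p.natDegree := by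
      rw [add_pow, eq_sub_iff_add_eq]
      have hsplit : range (p.natDegree + 1) = insert 0 (Icc 1 p.natDegree) := by
        ext m; simp only [mem_range, mem_insert, mem_Icc]; omega
      rw [hsplit, sum_insert (by simp), pow_zero, Nat.sub_zero, one_mul, Nat.choose_zero_right,
        Nat.cast_one, mul_one, add_comm]
      congr 1
      exact sum_congr rfl fun m _ => by ring
    rw [hbinom] at hsum
    have h4 : ρ ^ p.natDegree ≤ (ρ₁ + ρ) ^ p.natDegree - ρ ^ p.natDegree :=
      le_of_mul_le_mul_left hsum hb0
    rw [add_comm ρ₁] at h4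
    linarith

/-- **Theorem 6.4i (Birkhoff), radius form.** Under the hypotheses of `exists_root_two_mul_pow_le`
some zero of `p` satisfies `(2^{1/n} - 1) ‖w - z₀‖ ≤ ρ₁`, i.e. the closed disc
`‖z - z₀‖ ≤ ρ₁ / (2^{1/n} - 1)` about `z₀` contains a zero. [cite: Henrici1974, §6.4 Thm 6.4i] -/
theorem exists_root_norm_sub_le_div_rpow_sub_one {p : K[X]} (hs : p.Splits)
    (hn : 0 < p.natDegree) {z₀ : K} {ρ₁ : ℝ} (hρ₁ : 0 ≤ ρ₁)
    (h : ‖p.eval z₀‖ ≤ ∑ m ∈ Icc 1 p.natDegree, ‖(taylor z₀ p).coeff m‖ * ρ₁ ^ m) :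
    ∃ w ∈ p.roots, ‖w - z₀‖ ≤ ρ₁ / ((2 : ℝ) ^ ((p.natDegree : ℝ)⁻¹) - 1) := by
  obtain ⟨w, hw, -, h2⟩ := exists_root_two_mul_pow_le hs hn hρ₁ h
  refine ⟨w, hw, ?_⟩
  set ρ := ‖w - z₀‖
  have hρ : 0 ≤ ρ := norm_nonneg _
  have hn' : (p.natDegree : ℝ)⁻¹ * p.natDegree = 1 := by
    rw [inv_mul_cancel₀]; exact_mod_cast hn.ne'
  -- take `n`-th roots: `2^{1/n} ρ ≤ ρ + ρ₁`
  have h3 : (2 : ℝ) ^ ((p.natDegree : ℝ)⁻¹) * ρ ≤ ρ + ρ₁ := by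
    have := Real.rpow_le_rpow (by positivity) h2 (inv_nonneg.mpr (Nat.cast_nonneg p.natDegree))
    rwa [Real.mul_rpow (by norm_num) (pow_nonneg hρ _), Real.pow_rpow_inv_natCast hρ hn.ne',
      Real.pow_rpow_inv_natCast (add_nonneg hρ hρ₁) hn.ne'] at this
  have hgt : 1 < (2 : ℝ) ^ ((p.natDegree : ℝ)⁻¹) :=
    Real.one_lt_rpow (by norm_num) (inv_pos.mpr (by exact_mod_cast hn))
  rw [le_div_iff₀ (sub_pos.mpr hgt)]
  linarith

end Literature.Algebra.Polynomial.NearestZeroBounds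

end
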